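/-
Origin: expansion seat `planner-pub-hodgecm-mc-axioms-1-g14-0`, handover #W236 2026-08-20T15:53:55Z md5 44f7951c5187 (PKG f8213b40b42c → 44f7951c5187; 316 l.; MECHANICAL (iib-R) rewrite v3.1 of the PKG file as it stands (44 token edits; rules R1x1+RX[h₂]x43)) (`HOME/mc/pub-hodgecm-mc-axioms-1-g14/revendor/kit-r55/stage55/HodgeCM/Model/Binders/MeetBridgesSeesaw.lean`, md5 44f7951c5187, 316 lines);
landed by the gen-22 packager (p-g22) in gate run 55 REPLACES the earlier landed copy of `HodgeCM/Model/Binders/MeetBridgesSeesaw.lean` (seat copy carried the packager Origin header of an earlier run (stripped)).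
-/
/-
Origin: speedrun cell pub-hodgecm, MODEL-CONSTRUCTION sub-cell, unit pub-hodgecm-mc-binder-1-g6 (BINDER PROVER, gen 6; node
B2-meet, BINDER-OWNERS row 14, junction (J-seesaw)), seat prover-pub-hodgecm-mc-binder-1-g6-0, 2026-08-19.
″ RE-CUT (adm) by prover-pub-hodgecm-mc-binder-1-g7-0, 2026-08-19: `SeesawHyp` takes the admissibility predicate `adm` of
`Gen12Junctions.Adm` and (SS-K) `wedge_mem` is asked for ADMISSIBLE situations only (strict + saturated at the (Θ-sat) pin).
Target in PKG: HodgeCM/Model/Binders/MeetBridgesSeesaw.lean (NEW additive leaf; imports `Model/Binders/Gen12TorusPeriodW` (kit #4);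
nothing landed imports it).  KERNEL ONLY: the see-saw data `SeesawHyp` is a HYPOTHESIS record (never asserted); 0 records of published
theorems, nothing cited, MODEL-N 0.
-/
import Summits.HodgeConjecture.HodgeCM.Model.Binders.Gen12TorusPeriodW

/-!
# (J-seesaw) at the pin: the `seesaw` field of `Gen12Junctions` from the W ↔ S restriction identity

`Binders/Gen12Junctions` reduces E's binder `gen12` to four junctions; its field `seesaw` asks that the realised global wedge-function of
two GENERATING theta forms `θ₀ = θ(j₀, f₀)` (pair `(S V c).P 0`), `θ₁ = θ(j₁, f₁)` (pair `P 1`) lie in the span of the model generators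
`ϑ₁₂(χ, Φ)`.  This file proves it from the see-saw hypothesis record `SeesawHyp hHD hI h₁ h₃ h hA W S μ V c hV`:

* `τ` — a pairing of small test functions into the W-block's Schwartz–Bruhat space (the pure tensor `φ₁ ⊗ φ₂` read in the W-block's
  coordinates; tree `GelbartRogawski1991/UnitaryDualPairSeesawThetaProduct.seesawTensor`);
* (SS) `seesaw` — **the restriction identity at Θ-values**: `Θ_W(W.ρ(eV g, eW (jT₁₂ t)) (τ φ₁ φ₂)) = Θ₃(P₀.ω(g, t₁) φ₁) · Θ₃(P₁.ω(g, t₂) φ₂)`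
  (PerL v5 Lemma «seesaw», tex ll. 318–326; for the honest `(W, S)` this is the (S-restr) design rule `P k := twist charSmall_k (ω_{V,W} ∘
  pairSmall_k s_k)` read at Θ-values — tree #20 `thetaDistLM_pairRep_blockDiag_seesawTensor`, #22, #25; producer: period-1 lineage
  `Model/ArchSideTerm.lean`, `P_eq_restrict`);
* (SS-K) `wedge_mem` — the wedge test function `τ φ₀⁰ φ₁¹ − τ φ₀¹ φ₁⁰` of the two `K`-type-pinned pairs lies in `𝒮^κ = W.SK` (PerL l. 341;
  tree #23 `seesawWedge_mem_weightSpace` + the W2-Kn integers);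
* (hμ) `char_mem` — the product of the two weight characters has the side's archimedean type: `charPair χ′₀ χ′₁ ∈ allowedChars
  (d12Of μ c).m₁ (d12Of μ c).m₂` (the `μOf` read-off of the pins).

THE PROOF (`seesaw_of_seesawHyp`): a coordinate of a generating theta form at `x⁻¹` is the scalar lift `∫_{[U(1)]} θ_φ(xΓ_U, q) f(q) dq`
(`apply_thetaForm`, `thetaLift_apply`), the kernel is `Θ(P.ω(x⁻¹, u⁻¹) φ)` and the weight function is `q ↦ χ′(q⁻¹)`, so after the
inversion `u ↦ u⁻¹` on the compact abelian `[U(1)]` (`integral_inv_eq_self`, PKG instance `isInvInvariant_probHaarRelNormOneQuot`) the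
coordinate is `∫ Θ(P.ω(x⁻¹, u) φ) χ′(u) du`; the product of two coordinates is ONE integral over `[U(W₁)] × [U(W₂)]`
(`integral_prod_mul`), which (SS) + `dualChar (charPair χ′₀ χ′₁) (u₁u₂) = χ′₀(u₁)χ′₁(u₂)` identify with `torusPeriodW (W V c) χ (τ φ φ′) x`
(kit #4); the wedge is the difference of two such, `= torusPeriodW … (τφ₀⁰φ₁¹ − τφ₀¹φ₁⁰)` by linearity, `= ν_T(𝓕_T)⁻¹ • ϑc χ Φw (xΓ_U)` by
`t12_ϑc_mk_eq_smul_torusPeriodW`, hence `realise (θ₀ ∧ θ₁) = ν_T(𝓕_T)⁻¹ • ϑ₁₂(χ, Φw)` — ONE generator (for single theta series the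
wedge IS one lift; sums are handled by `Gen12Junctions`' span bookkeeping).  Nothing here is a claim of the manuscripts under adjudication.
-/

set_option autoImplicit false

noncomputable section

open MeasureTheory NumberField
open scoped InnerProductSpace ENNReal

namespace HodgeCM.Model

open HodgeCM HodgeCM.Universe HodgeCM.PerL34.Annihilation
open Literature.NumberTheory.Weil1964
open Literature.NumberTheory.Automorphic (piSchwartzBruhat weightForms)
open Literature.NumberTheory.Automorphic.WeightForms (ClassMapDatum thetaClasses restrictHom IsLevelCorrected IsWeightMatched)
open Literature.AlgebraicGeometry.HodgeTheory
open Literature.NumberTheory.Automorphic.PicardCM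
open Literature.NumberTheory.Transcendental (Arapura2012_Cor_15_4_6)
open HodgeCM.Model.ThetaSpace HodgeCM.Model.SupplyResidual

variable (hHD : exists_isReal_hodgeModel) (hI : hodgePQ_independent_of_hodgeModel)
  (h₁ : BallQuotientUniformised)  (h₃ : CMAbelianVarietyRealised)
variable (h : Bool) (hA : Arapura2012_Cor_15_4_6)
  (W : ∀ {L : CMField} {ι₁ : L →+* ℂ} (V : HermSpace3 L ι₁) (c : SeesawCtx L), WmInput V c.D)
  (S : ∀ {L : CMField} {ι₁ : L →+* ℂ} (V : HermSpace3 L ι₁) (c : SeesawCtx L), ThetaAdelicSide V c)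
  (μ : ∀ {L : CMField}, SeesawCtx L → Fin 4 → InfinitePlace L → ℤ)
variable {L : CMField} {ι₁ : L →+* ℂ} (V : HermSpace3 L ι₁) (c : SeesawCtx L) (hV : IsAnisotropic L V.Hm)

local notation3 "L⁺" => maximalRealSubfield (L : Type)

/- the ADMISSIBILITY predicate on `K`-type situations (`Gen12Junctions.Adm`; at the (Θ-sat) pin: saturated at the level's compact open
and strict) — (SS-K) is asked for admissible situations only -/
variable (adm : ∀ (Γ : Level V) (k : Fin 4),
    KTypeSituation ((pinX hHD hI h₁ h₃ S V c hV).P k) ((pinX hHD hI h₁ h₃ S V c hV).ιinf Γ) ((pinX hHD hI h₁ h₃ S V c hV).Δ Γ) (pinX hHD hI h₁ h₃ S V c hV).κ₁ (pinX hHD hI h₁ h₃ S V c hV).τ₁ → Prop)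

/-! ## 1. The see-saw hypothesis record -/

/-- **The see-saw hypotheses at the context `(V, c)`** (junction (J-seesaw) of `Gen12Junctions`, split into its three producers).
A HYPOTHESIS record — nothing here is asserted. -/
structure SeesawHyp where
  /-- the pure tensor of two small test functions, read in the W-block's Schwartz–Bruhat space -/
  τ : piSchwartzBruhat L⁺ (Fin 3) → piSchwartzBruhat L⁺ (Fin 3) → piSchwartzBruhat (W V c).F (W V c).ι
  /-- (SS) the restriction identity at Θ-values along `eV` / `eW ∘ jT₁₂` (PerL Lemma «seesaw»; (S-restr) `P_eq_restrict`) -/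
  seesaw : ∀ (g : ↥(Adelic.regimeSubgroup L V.Hm)) (t : SeesawTorus L⁺ L) (φ₁ φ₂ : piSchwartzBruhat L⁺ (Fin 3)),
    thetaDistLM (W V c).F (W V c).ι
        ((((W V c).ρ ((W V c).eV (g : ↥(Adelic.adelicUnitaryGroup L V.Hm)), (W V c).eW (c.D.jT₁₂ t))) :
          Module.End ℂ (piSchwartzBruhat (W V c).F (W V c).ι)) (τ φ₁ φ₂)) =
      thetaDistLM L⁺ (Fin 3) (((S V c).P 0).ω (g, SeesawTorus.fst L⁺ L t) φ₁) *
        thetaDistLM L⁺ (Fin 3) (((S V c).P 1).ω (g, SeesawTorus.snd L⁺ L t) φ₂)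
  /-- (SS-K) the wedge test function of two `K`-type-pinned pairs of ADMISSIBLE situations lies in `𝒮^κ` -/
  wedge_mem : ∀ (Γ : Level V)
    (Sit₀ : KTypeSituation ((pinX hHD hI h₁ h₃ S V c hV).P 0) ((pinX hHD hI h₁ h₃ S V c hV).ιinf Γ)
      ((pinX hHD hI h₁ h₃ S V c hV).Δ Γ) (pinX hHD hI h₁ h₃ S V c hV).κ₁ (pinX hHD hI h₁ h₃ S V c hV).τ₁)
    (Sit₁ : KTypeSituation ((pinX hHD hI h₁ h₃ S V c hV).P 1) ((pinX hHD hI h₁ h₃ S V c hV).ιinf Γ)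
      ((pinX hHD hI h₁ h₃ S V c hV).Δ Γ) (pinX hHD hI h₁ h₃ S V c hV).κ₁ (pinX hHD hI h₁ h₃ S V c hV).τ₁),
    adm Γ 0 Sit₀ → adm Γ 1 Sit₁ → ∀ j₀ ∈ Sit₀.𝓙, ∀ j₁ ∈ Sit₁.𝓙,
      τ (j₀.1 (Sit₀.ι (LinearMap.proj 0))) (j₁.1 (Sit₁.ι (LinearMap.proj 1))) -
        τ (j₀.1 (Sit₀.ι (LinearMap.proj 1))) (j₁.1 (Sit₁.ι (LinearMap.proj 0))) ∈ (W V c).SK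
  /-- (hμ) the product of two weight characters of the two lines has the archimedean type of the (12) side -/
  char_mem : ∀ (χ₀ χ₁ : PontryaginDual (relNormOneIdeles L⁺ L ⧸ relNormOneRat L⁺ L)),
    (∀ t : Literature.NumberTheory.Automorphic.relNormOneInfUnits L⁺ L,
      ((χ₀ (QuotientGroup.mk (Literature.NumberTheory.Automorphic.relNormOneInfToIdeles L⁺ L t)) : Circle) : ℂ) *
        ((S V c).P 0).w t = 1) →
    (∀ t : Literature.NumberTheory.Automorphic.relNormOneInfUnits L⁺ L,
      ((χ₁ (QuotientGroup.mk (Literature.NumberTheory.Automorphic.relNormOneInfToIdeles L⁺ L t)) : Circle) : ℂ) *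
        ((S V c).P 1).w t = 1) →
    SeesawTorus.charPair χ₀ χ₁ ∈ SeesawTorus.allowedChars (L : Type) (d12Of μ c).m₁ (d12Of μ c).m₂

/-! ## 2. Scalar lemmas: a coordinate of a generating theta form is a `[U(1)]`-period -/

/-- the pinned theta-space INPUT of the context (kit #2 `pinX`; its `.K = L⁺`, `.L = L`, `.P = (S V c).P` by `rfl`) -/
local notation3 "𝕏" => pinX hHD hI h₁ h₃ S V c hV

/-- the compact line quotient `[U(1)] = U(1)(L⁺)\U(1)(𝔸_{L⁺})` in the INPUT's typing -/
local notation3 "𝕌" => (↥(Literature.NumberTheory.Automorphic.relNormOneIdeles (𝕏).K (𝕏).L) ⧸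
  Literature.NumberTheory.Automorphic.relNormOneRat (𝕏).K (𝕏).L)

/-- its probability Haar measure `du` -/
local notation3 "d𝕌" => Literature.NumberTheory.Automorphic.probHaarRelNormOneQuot (𝕏).K (𝕏).L

/-- The kernel of the pair datum `P k` at an inverted torus point: `θ_φ(xΓ_U, (uΓ)⁻¹) = Θ(P.ω(x⁻¹, u) φ)`. -/
theorem thetaKer_mk_inv (k : Fin 4) (Φ : piSchwartzBruhat (𝕏).K (Fin 3)) (x : (𝕏).GU)
    (u : ↥(Literature.NumberTheory.Automorphic.relNormOneIdeles (𝕏).K (𝕏).L)) :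
    ((𝕏).P k).kernelDatum.thetaKer (((𝕏).P k).weilDatum.toThetaTop Φ) (QuotientGroup.mk x, (QuotientGroup.mk u : 𝕌)⁻¹) =
      thetaDistLM (𝕏).K (Fin 3) (((𝕏).P k).ω (x⁻¹, u) Φ) := by
  rw [← QuotientGroup.mk_inv, ThetaKernelDatum.thetaKer_mk]
  have h := ((𝕏).P k).kernelDatum_thetaFun_mk Φ x u⁻¹
  rw [inv_inv] at h
  exact h

/-- **A coordinate of a generating theta form at `x⁻¹` is the `[U(1)]`-period `∫ θ_φᵢ(xΓ_U, (uΓ)⁻¹) χ′(uΓ) du`** (`apply_thetaForm`,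
`thetaLift_apply`, the weight function `q ↦ χ′(q⁻¹)`, inversion-invariance of `du`). -/
theorem coord_thetaForm_eq_integral (k : Fin 4) (Γ : Level V)
    (Sit : KTypeSituation ((𝕏).P k) ((𝕏).ιinf Γ) ((𝕏).Δ Γ) (𝕏).κ₁ (𝕏).τ₁)
    (j : {j : Sit.E →ₗ[ℂ] ((𝕏).P k).weilDatum.ThetaTop // ((𝕏).P k).kernelDatum.IsThetaEquivariant Sit.κ Sit.σ j})
    (χ' : PontryaginDual 𝕌) (i : Fin 2) (x : (𝕏).GU) :
    (((𝕏).P k).kernelDatum.thetaForm d𝕌 ((𝕏).P k).kernelDatum_thetaLinear Sit.κ j.1 j.2 Sit.ι Sit.hι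
        (WeilPairData.charInv χ')).1 x⁻¹ i =
      ∫ q, ((𝕏).P k).kernelDatum.thetaKer (j.1 (Sit.ι (LinearMap.proj i))) (QuotientGroup.mk x, q⁻¹) * ((χ' q : Circle) : ℂ) ∂d𝕌 := by
  have happ := ((𝕏).P k).kernelDatum.apply_thetaForm d𝕌 ((𝕏).P k).kernelDatum_thetaLinear Sit.κ j.1 j.2 Sit.ι Sit.hι
    (WeilPairData.charInv χ') x⁻¹ (LinearMap.proj i)
  have h2 : ((𝕏).P k).kernelDatum.thetaLiftFun d𝕌 (j.1 (Sit.ι (LinearMap.proj i))) (WeilPairData.charInv χ') x⁻¹ =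
      ∫ q, ((𝕏).P k).kernelDatum.thetaKer (j.1 (Sit.ι (LinearMap.proj i))) (QuotientGroup.mk x, q⁻¹) * ((χ' q : Circle) : ℂ)
        ∂d𝕌 := by
    rw [ThetaKernelDatum.thetaLiftFun, inv_inv, ThetaKernelDatum.thetaLift_apply,
      ← integral_inv_eq_self (fun q => ((𝕏).P k).kernelDatum.thetaKer (j.1 (Sit.ι (LinearMap.proj i)))
          (QuotientGroup.mk x, q) * WeilPairData.charInv χ' q) d𝕌]
    refine integral_congr_ae (Filter.Eventually.of_forall fun q => ?_)
    show ((𝕏).P k).kernelDatum.thetaKer (j.1 (Sit.ι (LinearMap.proj i))) (QuotientGroup.mk x, q⁻¹) *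
        WeilPairData.charInv χ' q⁻¹ =
      ((𝕏).P k).kernelDatum.thetaKer (j.1 (Sit.ι (LinearMap.proj i))) (QuotientGroup.mk x, q⁻¹) * ((χ' q : Circle) : ℂ)
    exact congrArg (fun z : 𝕌 => ((𝕏).P k).kernelDatum.thetaKer (j.1 (Sit.ι (LinearMap.proj i))) (QuotientGroup.mk x, q⁻¹) *
      ((χ' z : Circle) : ℂ)) (inv_inv q)
  exact happ.trans h2

/-! ## 3. The product of two coordinates is ONE `[U(W₁)] × [U(W₂)]`-period: the W-block's torus period, by (SS) -/

/-- `dualChar` (PKG `PerL34/Annihilation`) IS `SeesawTorus.toComplexChar` (PKG `PerL34/SeesawFubini`). -/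
theorem dualChar_eq_toComplexChar (ξ : PontryaginDual (SeesawTorus L⁺ L ⧸ SeesawTorus.rat L⁺ L)) :
    dualChar ξ = SeesawTorus.toComplexChar ξ := rfl

/-- `[U(W₁)] × [U(W₂)] → [T]`, `(u₁Γ, u₂Γ) ↦ (u₁, u₂)T(L₀)` on representatives. -/
theorem quotInl_mk_mul_quotInr_mk (u₁ u₂ : relNormOneIdeles L⁺ L) :
    SeesawTorus.quotInl L⁺ L (QuotientGroup.mk u₁) * SeesawTorus.quotInr L⁺ L (QuotientGroup.mk u₂) =
      (QuotientGroup.mk (SeesawTorus.mk L⁺ L u₁ u₂) : SeesawTorus L⁺ L ⧸ SeesawTorus.rat L⁺ L) := by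
  rw [SeesawTorus.quotInl_mk, SeesawTorus.quotInr_mk, ← QuotientGroup.mk_mul, SeesawTorus.inl_mul_inr]

/-- **(SS) integrated**: `(∫ Θ(P₀.ω(x⁻¹,u) φ₀) χ₀(u) du) · (∫ Θ(P₁.ω(x⁻¹,u) φ₁) χ₁(u) du) = torusPeriodW (W V c) (χ₀ ⊠ χ₁) (τ φ₀ φ₁) x`
(`integral_prod_mul`; pointwise on representatives: `thetaKer_mk_inv`, `toComplexChar_charPair_inl_mul_inr`, the see-saw identity).
(The two typings of `x` — `↥(regimeSubgroup L V.Hm)` for the W-block, the INPUT's `GU` for the kernels — agree by `rfl`; the proof is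
kept in term mode where they meet.) -/
theorem integral_mul_integral_eq_torusPeriodW (H : SeesawHyp hHD hI h₁ h₃ W S μ V c hV adm)
    (φ₀ φ₁ : piSchwartzBruhat (𝕏).K (Fin 3)) (χ₀ χ₁ : PontryaginDual 𝕌) (x : ↥(Adelic.regimeSubgroup L V.Hm)) :
    (∫ q, ((𝕏).P 0).kernelDatum.thetaKer (((𝕏).P 0).weilDatum.toThetaTop φ₀) (QuotientGroup.mk x, q⁻¹) *
        ((χ₀ q : Circle) : ℂ) ∂d𝕌) *
      (∫ q, ((𝕏).P 1).kernelDatum.thetaKer (((𝕏).P 1).weilDatum.toThetaTop φ₁) (QuotientGroup.mk x, q⁻¹) *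
        ((χ₁ q : Circle) : ℂ) ∂d𝕌) =
      torusPeriodW (W V c) (SeesawTorus.charPair χ₀ χ₁) (H.τ φ₀ φ₁) (x : ↥(Adelic.adelicUnitaryGroup L V.Hm)) := by
  rw [← integral_prod_mul]
  unfold torusPeriodW
  refine integral_congr_ae (Filter.Eventually.of_forall fun p => ?_)
  obtain ⟨q₁, q₂⟩ := p
  induction q₁ using QuotientGroup.induction_on with
  | H u₁ =>
    induction q₂ using QuotientGroup.induction_on with
    | H u₂ =>
      -- the two kernels at the inverted torus points
      have k0 : ((𝕏).P 0).kernelDatum.thetaKer (((𝕏).P 0).weilDatum.toThetaTop φ₀)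
            (QuotientGroup.mk x, (QuotientGroup.mk u₁ : 𝕌)⁻¹) =
          thetaDistLM (𝕏).K (Fin 3) (((𝕏).P 0).ω (x⁻¹, u₁) φ₀) := thetaKer_mk_inv hHD hI h₁ h₃ S V c hV 0 φ₀ x u₁
      have k1 : ((𝕏).P 1).kernelDatum.thetaKer (((𝕏).P 1).weilDatum.toThetaTop φ₁)
            (QuotientGroup.mk x, (QuotientGroup.mk u₂ : 𝕌)⁻¹) =
          thetaDistLM (𝕏).K (Fin 3) (((𝕏).P 1).ω (x⁻¹, u₂) φ₁) := thetaKer_mk_inv hHD hI h₁ h₃ S V c hV 1 φ₁ x u₂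
      -- the product character
      have kc : dualChar (SeesawTorus.charPair χ₀ χ₁)
            (SeesawTorus.quotInl L⁺ L (QuotientGroup.mk u₁) * SeesawTorus.quotInr L⁺ L (QuotientGroup.mk u₂)) =
          ((χ₀ (QuotientGroup.mk u₁) : Circle) : ℂ) * ((χ₁ (QuotientGroup.mk u₂) : Circle) : ℂ) :=
        SeesawTorus.toComplexChar_charPair_inl_mul_inr χ₀ χ₁ _ _
      -- the W-block kernel on representatives
      have kw : thetaWQ (W V c) (H.τ φ₀ φ₁) (x : ↥(Adelic.adelicUnitaryGroup L V.Hm))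
            (SeesawTorus.quotInl L⁺ L (QuotientGroup.mk u₁) * SeesawTorus.quotInr L⁺ L (QuotientGroup.mk u₂)) =
          thetaDistLM (W V c).F (W V c).ι
            ((((W V c).ρ ((W V c).eV ((x : ↥(Adelic.adelicUnitaryGroup L V.Hm)))⁻¹,
                (W V c).eW (c.D.jT₁₂ (SeesawTorus.mk L⁺ L u₁ u₂)))) :
              Module.End ℂ (piSchwartzBruhat (W V c).F (W V c).ι)) (H.τ φ₀ φ₁)) := by
        rw [quotInl_mk_mul_quotInr_mk, thetaWQ_mk, thetaW_apply]
      -- the see-saw identity at `g = x⁻¹`, `t = (u₁, u₂)` (`↑(x⁻¹) = (↑x)⁻¹`, `fst/snd (mk u₁ u₂)` by `rfl`)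
      have hs : thetaDistLM (W V c).F (W V c).ι
            ((((W V c).ρ ((W V c).eV ((x : ↥(Adelic.adelicUnitaryGroup L V.Hm)))⁻¹,
                (W V c).eW (c.D.jT₁₂ (SeesawTorus.mk L⁺ L u₁ u₂)))) :
              Module.End ℂ (piSchwartzBruhat (W V c).F (W V c).ι)) (H.τ φ₀ φ₁)) =
          thetaDistLM (𝕏).K (Fin 3) (((𝕏).P 0).ω (x⁻¹, u₁) φ₀) * thetaDistLM (𝕏).K (Fin 3) (((𝕏).P 1).ω (x⁻¹, u₂) φ₁) :=
        H.seesaw x⁻¹ (SeesawTorus.mk L⁺ L u₁ u₂) φ₀ φ₁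
      show ((𝕏).P 0).kernelDatum.thetaKer (((𝕏).P 0).weilDatum.toThetaTop φ₀) (QuotientGroup.mk x, (QuotientGroup.mk u₁ : 𝕌)⁻¹) *
            ((χ₀ (QuotientGroup.mk u₁) : Circle) : ℂ) *
          (((𝕏).P 1).kernelDatum.thetaKer (((𝕏).P 1).weilDatum.toThetaTop φ₁) (QuotientGroup.mk x, (QuotientGroup.mk u₂ : 𝕌)⁻¹) *
            ((χ₁ (QuotientGroup.mk u₂) : Circle) : ℂ)) =
        dualChar (SeesawTorus.charPair χ₀ χ₁)
            (SeesawTorus.quotInl L⁺ L (QuotientGroup.mk u₁) * SeesawTorus.quotInr L⁺ L (QuotientGroup.mk u₂)) *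
          thetaWQ (W V c) (H.τ φ₀ φ₁) (x : ↥(Adelic.adelicUnitaryGroup L V.Hm))
            (SeesawTorus.quotInl L⁺ L (QuotientGroup.mk u₁) * SeesawTorus.quotInr L⁺ L (QuotientGroup.mk u₂))
      calc _ = thetaDistLM (𝕏).K (Fin 3) (((𝕏).P 0).ω (x⁻¹, u₁) φ₀) * ((χ₀ (QuotientGroup.mk u₁) : Circle) : ℂ) *
            (thetaDistLM (𝕏).K (Fin 3) (((𝕏).P 1).ω (x⁻¹, u₂) φ₁) * ((χ₁ (QuotientGroup.mk u₂) : Circle) : ℂ)) :=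
          congrArg₂ (· * ·) (congrArg (· * ((χ₀ (QuotientGroup.mk u₁) : Circle) : ℂ)) k0)
            (congrArg (· * ((χ₁ (QuotientGroup.mk u₂) : Circle) : ℂ)) k1)
        _ = ((χ₀ (QuotientGroup.mk u₁) : Circle) : ℂ) * ((χ₁ (QuotientGroup.mk u₂) : Circle) : ℂ) *
            (thetaDistLM (𝕏).K (Fin 3) (((𝕏).P 0).ω (x⁻¹, u₁) φ₀) * thetaDistLM (𝕏).K (Fin 3) (((𝕏).P 1).ω (x⁻¹, u₂) φ₁)) := by
          ring
        _ = _ := (congrArg₂ (· * ·) kc (kw.trans hs)).symm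

/-! ## 4. (J-seesaw) — the `seesaw` field of `Gen12Junctions` -/

set_option maxHeartbeats 1600000 in
/-- **(J-seesaw) DISCHARGED from `SeesawHyp`**: for GENERATING theta forms `θ₀ ∈ thetaGen Γ 0`, `θ₁ ∈ thetaGen Γ 1`, the realised
global wedge-function is `ν_T(𝓕_T)⁻¹ • ϑ₁₂(χ₀ ⊠ χ₁, τφ₀⁰φ₁¹ − τφ₀¹φ₁⁰)` — ONE model generator — hence lies in the span of
`gen12Set` (the `seesaw` field of `Gen12Junctions hHD hI h₁ h₃ h hA W S μ V c hV`, verbatim). -/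
theorem seesaw_of_seesawHyp (hW : IsAnisotropic L c.D.gramW) (H : SeesawHyp hHD hI h₁ h₃ W S μ V c hV adm) :
    ∀ (Γ : Level V), ∀ F ∈ thetaGen hHD hI h₁ h₃ S V c hV Γ 0 (adm Γ 0), ∀ F' ∈ thetaGen hHD hI h₁ h₃ S V c hV Γ 1 (adm Γ 1),
      ((quotU V).realise ((quotU V).wedge₂ F F') : (pinT hHD hI h₁ h₃ h hA W S μ).HG L ι₁ V) ∈
        Submodule.span ℂ ((pinT hHD hI h₁ h₃ h hA W S μ).gen12Set V c) := by
  intro Γ F hF F' hF'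
  obtain ⟨Sit₀, had₀, j₀, hj₀, f₀, hf₀, hF0⟩ := hF
  obtain ⟨Sit₁, had₁, j₁, hj₁, f₁, hf₁, hF1⟩ := hF'
  obtain ⟨χ₀, hχ₀, rfl⟩ := hf₀
  obtain ⟨χ₁, hχ₁, rfl⟩ := hf₁
  -- the four K-type-pinned test functions, as plain Schwartz–Bruhat functions (hides `j`'s dependent type)
  set φ₀₀ : piSchwartzBruhat (𝕏).K (Fin 3) := j₀.1 (Sit₀.ι (LinearMap.proj 0)) with hφ₀₀
  set φ₀₁ : piSchwartzBruhat (𝕏).K (Fin 3) := j₀.1 (Sit₀.ι (LinearMap.proj 1)) with hφ₀₁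
  set φ₁₀ : piSchwartzBruhat (𝕏).K (Fin 3) := j₁.1 (Sit₁.ι (LinearMap.proj 0)) with hφ₁₀
  set φ₁₁ : piSchwartzBruhat (𝕏).K (Fin 3) := j₁.1 (Sit₁.ι (LinearMap.proj 1)) with hφ₁₁
  -- the character and the wedge test function of the single generator
  let χ : ((pinT hHD hI h₁ h₃ h hA W S μ).t12 V c).X := ⟨SeesawTorus.charPair χ₀ χ₁, H.char_mem χ₀ χ₁ hχ₀ hχ₁⟩
  let Φw : (pinT hHD hI h₁ h₃ h hA W S μ).SK V c :=
    ⟨H.τ φ₀₀ φ₁₁ - H.τ φ₀₁ φ₁₀, H.wedge_mem Γ Sit₀ Sit₁ had₀ had₁ j₀ hj₀ j₁ hj₁⟩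
  -- the covolume constant
  set ν𝓕 : ℝ := (SeesawTorus.haar L⁺ L (SeesawTorus.fundamentalDomain L⁺ L)).toReal with hν𝓕
  have hν : ν𝓕 ≠ 0 := CompactRest.haar_fundamentalDomain_toReal_ne_zero (L := (L : Type))
  -- VALUE BY VALUE: the descended wedge-function is `ν𝓕⁻¹ •` the model period function
  have hfun : (quotU V).descendInv ((quotU V).wedge₂ F F') =
      ((ν𝓕⁻¹ : ℝ) : ℂ) • (pinR12 hHD hI h₁ h₃ h hA W S μ V c).kt.ϑc χ Φw := by
    ext ξ
    induction ξ using QuotientGroup.induction_on with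
    | H x =>
      -- read the representative in `U(V)`'s regime subgroup (the same type, so that `↑x ∈ U(V)(𝔸)` elaborates)
      obtain ⟨x, rfl⟩ : ∃ x' : ↥(Adelic.regimeSubgroup L V.Hm), x' = x := ⟨x, rfl⟩
      rw [ContinuousMap.smul_apply, QuotientModel.descendInv_mk, QuotientModel.coe_wedge₂, QuotientModel.wedge₂Fun_apply,
        smul_eq_mul]
      -- the four coordinates as `[U(1)]`-periods
      have e00 : F.1 x⁻¹ 0 = ∫ q, ((𝕏).P 0).kernelDatum.thetaKer φ₀₀ (QuotientGroup.mk x, q⁻¹) * ((χ₀ q : Circle) : ℂ) ∂d𝕌 :=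
        (congrFun (congrFun hF0 x⁻¹) 0).trans (coord_thetaForm_eq_integral hHD hI h₁ h₃ S V c hV 0 Γ Sit₀ j₀ χ₀ 0 x)
      have e01 : F.1 x⁻¹ 1 = ∫ q, ((𝕏).P 0).kernelDatum.thetaKer φ₀₁ (QuotientGroup.mk x, q⁻¹) * ((χ₀ q : Circle) : ℂ) ∂d𝕌 :=
        (congrFun (congrFun hF0 x⁻¹) 1).trans (coord_thetaForm_eq_integral hHD hI h₁ h₃ S V c hV 0 Γ Sit₀ j₀ χ₀ 1 x)
      have e10 : F'.1 x⁻¹ 0 = ∫ q, ((𝕏).P 1).kernelDatum.thetaKer φ₁₀ (QuotientGroup.mk x, q⁻¹) * ((χ₁ q : Circle) : ℂ) ∂d𝕌 :=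
        (congrFun (congrFun hF1 x⁻¹) 0).trans (coord_thetaForm_eq_integral hHD hI h₁ h₃ S V c hV 1 Γ Sit₁ j₁ χ₁ 0 x)
      have e11 : F'.1 x⁻¹ 1 = ∫ q, ((𝕏).P 1).kernelDatum.thetaKer φ₁₁ (QuotientGroup.mk x, q⁻¹) * ((χ₁ q : Circle) : ℂ) ∂d𝕌 :=
        (congrFun (congrFun hF1 x⁻¹) 1).trans (coord_thetaForm_eq_integral hHD hI h₁ h₃ S V c hV 1 Γ Sit₁ j₁ χ₁ 1 x)
      -- the wedge of coordinates is the W-block period of the wedge test function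
      have eL : F.1 x⁻¹ 0 * F'.1 x⁻¹ 1 - F.1 x⁻¹ 1 * F'.1 x⁻¹ 0 =
          torusPeriodW (W V c) (SeesawTorus.charPair χ₀ χ₁) (H.τ φ₀₀ φ₁₁) (x : ↥(Adelic.adelicUnitaryGroup L V.Hm)) -
            torusPeriodW (W V c) (SeesawTorus.charPair χ₀ χ₁) (H.τ φ₀₁ φ₁₀) (x : ↥(Adelic.adelicUnitaryGroup L V.Hm)) :=
        (congrArg₂ (fun a b : ℂ => a - b) (congrArg₂ (· * ·) e00 e11) (congrArg₂ (· * ·) e01 e10)).trans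
          (congrArg₂ (fun a b : ℂ => a - b)
            (integral_mul_integral_eq_torusPeriodW hHD hI h₁ h₃ W S μ V c hV adm H φ₀₀ φ₁₁ χ₀ χ₁ x)
            (integral_mul_integral_eq_torusPeriodW hHD hI h₁ h₃ W S μ V c hV adm H φ₀₁ φ₁₀ χ₀ χ₁ x))
      have eW : torusPeriodW (W V c) χ.1 Φw.1 (x : ↥(Adelic.adelicUnitaryGroup L V.Hm)) =
          torusPeriodW (W V c) (SeesawTorus.charPair χ₀ χ₁) (H.τ φ₀₀ φ₁₁) (x : ↥(Adelic.adelicUnitaryGroup L V.Hm)) -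
            torusPeriodW (W V c) (SeesawTorus.charPair χ₀ χ₁) (H.τ φ₀₁ φ₁₀) (x : ↥(Adelic.adelicUnitaryGroup L V.Hm)) :=
        torusPeriodW_sub (W V c) (SeesawTorus.charPair χ₀ χ₁) (H.τ φ₀₀ φ₁₁) (H.τ φ₀₁ φ₁₀) _
      -- the model period at `xΓ_U` (kit #4) with the covolume constant
      have eR : (pinR12 hHD hI h₁ h₃ h hA W S μ V c).kt.ϑc χ Φw (QuotientGroup.mk x) =
          (((SeesawTorus.haar L⁺ L (SeesawTorus.fundamentalDomain L⁺ L)).toReal : ℝ) : ℂ) *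
            torusPeriodW (W V c) χ.1 Φw.1 (x : ↥(Adelic.adelicUnitaryGroup L V.Hm)) :=
        (t12_ϑc_mk_eq_smul_torusPeriodW hHD hI h₁ h₃ h hA W S μ V c hW χ Φw x).trans (Complex.real_smul)
      have hc : ((ν𝓕⁻¹ : ℝ) : ℂ) * ((SeesawTorus.haar L⁺ L (SeesawTorus.fundamentalDomain L⁺ L)).toReal : ℂ) = 1 := by
        rw [← hν𝓕, ← Complex.ofReal_mul, inv_mul_cancel₀ hν, Complex.ofReal_one]
      calc F.1 x⁻¹ 0 * F'.1 x⁻¹ 1 - F.1 x⁻¹ 1 * F'.1 x⁻¹ 0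
          = torusPeriodW (W V c) χ.1 Φw.1 (x : ↥(Adelic.adelicUnitaryGroup L V.Hm)) := eL.trans eW.symm
        _ = 1 * torusPeriodW (W V c) χ.1 Φw.1 (x : ↥(Adelic.adelicUnitaryGroup L V.Hm)) := (one_mul _).symm
        _ = ((ν𝓕⁻¹ : ℝ) : ℂ) * ((SeesawTorus.haar L⁺ L (SeesawTorus.fundamentalDomain L⁺ L)).toReal : ℂ) *
              torusPeriodW (W V c) χ.1 Φw.1 (x : ↥(Adelic.adelicUnitaryGroup L V.Hm)) :=
            congrArg (· * torusPeriodW (W V c) χ.1 Φw.1 (x : ↥(Adelic.adelicUnitaryGroup L V.Hm))) hc.symm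
        _ = ((ν𝓕⁻¹ : ℝ) : ℂ) * (pinR12 hHD hI h₁ h₃ h hA W S μ V c).kt.ϑc χ Φw (QuotientGroup.mk x) :=
            (mul_assoc _ _ _).trans (congrArg (fun z : ℂ => ((ν𝓕⁻¹ : ℝ) : ℂ) * z) eR.symm)
  -- IN `L²`: `realise = toLp ∘ descendInv`, `ϑ χ Φ = toLp (ϑc χ Φ)` (kernel model), `toLp` is linear
  have hL2 : ((quotU V).realise ((quotU V).wedge₂ F F') : (pinT hHD hI h₁ h₃ h hA W S μ).HG L ι₁ V) =
      ((ν𝓕⁻¹ : ℝ) : ℂ) • (((pinT hHD hI h₁ h₃ h hA W S μ).t12 V c).ϑ χ Φw : (pinT hHD hI h₁ h₃ h hA W S μ).HG L ι₁ V) := by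
    rw [QuotientModel.realise_apply, hfun, map_smul, t12_ϑ_eq_toLp]
    rfl
  rw [hL2]
  exact (Submodule.span ℂ ((pinT hHD hI h₁ h₃ h hA W S μ).gen12Set V c)).smul_mem _
    (Submodule.subset_span (ThetaModel.ϑ_mem_gen12Set _ V c χ Φw))

end HodgeCM.Model

end
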